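import Summits.CriticalPhenomena.PercolationContinuityZ3.Theorems.PercNearOneGluingNoHeavyQuantIndepBlobFar
import Summits.CriticalPhenomena.PercolationContinuityZ3.Theorems.PercNearOneGluingNoHeavyQuantMergeStep
import HarnessLib

/-!
# QUANT lane R8, DIB\* with ONE LIGHT BLOB in the reliable regime `x³ + x ≥ 1`: independent blobs with gates `≥ x` plus one blob
# BELOW the floor, credited at the discounted rate `b·(g − x²)/(1 − x)` — merge, or Markov, and nothing else

builds on p205010 (kernel theorem, internal audit signed; external expert review pending)

Support file (`--supports stmt-CriticalPhenomena-4575`), QUANT lane census seat prim-quant-census-1 (gen 14), rung R8 of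
`run/shared/lean/prim/quant/LADDER.md`; memo `run/shared/lean/prim/quant/prim-quant-census-1/TREES-G14.md` §4.

CONTEXT.  census-2 g49 (`prim-quant-census-2-g49/ARCH-TREES-G49.md`) reduces `Quant.FarTreeRow` on every tree to the conjecture DIB\*
(discounted independent blobs): independent blobs, floor `x`, HEAVY blobs (gate `≥ x`) credited at `size·gate`, LIGHT blobs (gate `< x`,
size `≤ j`) at `size·(gate − x²)/(1 − x)`; credit `> 2j ⟹ P(N ≥ j+1) ≥ x`.  Its one-light-blob case ("D-root") is what the general hair of
LEAD-NOTES-G14 N25 needs.  This file proves the ONE-LIGHT-BLOB CASE FOR EVERY FLOOR `x` WITH `x³ + x ≥ 1` (`x ≥ 0.6824`; the regime of the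
budget-binding high-reliability configurations) by a law-free dichotomy:

* (G) if `g·(Σ heavy sizes) ≥ j`: the light blob MERGES into some heavy blob without raising the tail (p1 g8's law-free
  `Quant.Merge.exists_tailMerge_le`, targets = all heavy blobs); the merged collection is proper with budget `≥ B_H + b x > 2j`, so
  `IndepBlob.far_indepBlob` gives tail `≥ x`;
* (M) if `EN ≥ (1 − x)j + x·A` (`A` = total mass, `EN` = true mean): MARKOV on the closed mass, `TAIL ≥ (EN − j)/(A − j) ≥ x`;
* (∅) otherwise the three strict inequalities ¬G, ¬M, credit `> 2j` force `j(1−x)(g(1+x) − x) < b x g (1 − 2x + g)`, impossible for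
  `x² ≤ g ≤ x`, `b ≤ j`, `x³ + x ≥ 1` (a concave quadratic in `g`, nonnegative at `g = x²` and `g = x`).

* `IndepBlob.tail_ge_markov` — (M) for independent blobs plus one extra independent blob (any gates).
* `IndepBlob.oneLight_noGap` — the algebra of (∅).
* `IndepBlob.tail_ge_of_oneLight` — **THE ROW**: heavy blobs `(c i ∈ ℕ, p i ∈ [x,1])`, light blob `(b ≤ j, g ∈ [x², x])`, `x³ + x ≥ 1`,
  `2j < Σ c·p + b(g − x²)/(1−x)` ⟹ `x ≤ P(N ≥ j+1) = Σ_W wt(W)·(g·𝟙[j+1 ≤ c(W)+b] + (1−g)·𝟙[j+1 ≤ c(W)])`.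
Below `x ≤ 1/3` the row holds with the light blob at FULL credit (`IndepBlob.lowFloor_row`, `…QuantIndepBlobLowFloor.lean`); on `(1/3, 0.6824)`
the same three certificates plus Cantelli cover every sampled instance (memo §4: 1.2·10⁶ aggregate points, 0 uncovered) — not formalised here.
[cite: KozmaNitzan2024, Conjecture 3 (p. 15)] (the gluing rows served); the row is [this work].  Theorems only, no sorries, standard axioms.
-/

namespace Summit.CriticalPhenomena.PercolationContinuityZ3.Theorems

namespace Quant

namespace IndepBlob

open Finset

variable {ι : Type*} [Fintype ι] [DecidableEq ι]

/-- **Markov on the closed mass, independent blobs plus one extra independent blob.**  Gates `0 ≤ p i ≤ 1`, sizes `c i ∈ ℕ`, an extra blob of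
size `b` and gate `g ∈ [0,1]`, total mass `A = Σ c + b > j`.  Then `(EN − j)/(A − j) ≤ TAIL`, `EN = Σ c·p + b·g`, because pointwise
`𝟙[n ≥ j+1] ≥ (n − j)/(A − j)` for `n ≤ A`. [this work] -/
theorem tail_ge_markov (p : ι → ℝ) (hp0 : ∀ i, 0 ≤ p i) (hp1 : ∀ i, p i ≤ 1) (c : ι → ℕ) (b j : ℕ) (g : ℝ)
    (hg0 : 0 ≤ g) (hg1 : g ≤ 1) (hA : (j : ℝ) < (∑ i, (c i : ℝ)) + b) :
    ((∑ i, (c i : ℝ) * p i) + b * g - j) / ((∑ i, (c i : ℝ)) + b - j) ≤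
      ∑ W : Finset ι, (∏ k, if k ∈ W then p k else 1 - p k) *
        (g * (if j + 1 ≤ ∑ k ∈ W, c k + b then (1 : ℝ) else 0) +
          (1 - g) * (if j + 1 ≤ ∑ k ∈ W, c k then (1 : ℝ) else 0)) := by
  set A : ℝ := (∑ i, (c i : ℝ)) + b with hAdef
  have hAj : 0 < A - j := by linarith
  have hw0 : ∀ W : Finset ι, 0 ≤ (∏ k, if k ∈ W then p k else 1 - p k) := bernoulliWeight_nonneg hp0 hp1
  -- pointwise: the Markov ratio is below the indicator
  have hpt : ∀ (n : ℕ), (n : ℝ) ≤ A → ((n : ℝ) - j) / (A - j) ≤ (if j + 1 ≤ n then (1 : ℝ) else 0) := by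
    intro n hn
    split_ifs with h
    · rw [div_le_one hAj]; linarith
    · push Not at h
      have : (n : ℝ) ≤ j := by exact_mod_cast Nat.lt_succ_iff.mp h
      exact div_nonpos_of_nonpos_of_nonneg (by linarith) hAj.le
  have hcW : ∀ W : Finset ι, ∑ k ∈ W, (c k : ℝ) ≤ ∑ i, (c i : ℝ) := fun W =>
    Finset.sum_le_sum_of_subset_of_nonneg (Finset.subset_univ W) fun _ _ _ => Nat.cast_nonneg _
  -- lower bound configuration by configuration
  have hle : ∀ W : Finset ι,
      (∏ k, if k ∈ W then p k else 1 - p k) *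
          (g * ((((∑ k ∈ W, c k + b : ℕ) : ℝ) - j) / (A - j)) + (1 - g) * ((((∑ k ∈ W, c k : ℕ) : ℝ) - j) / (A - j))) ≤
        (∏ k, if k ∈ W then p k else 1 - p k) *
          (g * (if j + 1 ≤ ∑ k ∈ W, c k + b then (1 : ℝ) else 0) +
            (1 - g) * (if j + 1 ≤ ∑ k ∈ W, c k then (1 : ℝ) else 0)) := by
    intro W
    refine mul_le_mul_of_nonneg_left (add_le_add ?_ ?_) (hw0 W)
    · refine mul_le_mul_of_nonneg_left (hpt _ ?_) hg0
      push_cast; linarith [hcW W]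
    · refine mul_le_mul_of_nonneg_left (hpt _ ?_) (by linarith)
      push_cast; linarith [hcW W]
  refine le_trans (le_of_eq ?_) (Finset.sum_le_sum fun W _ => hle W)
  -- the left-hand side is the expectation of the Markov ratio
  have e1 : ∀ W : Finset ι, (∏ k, if k ∈ W then p k else 1 - p k) *
        (g * ((((∑ k ∈ W, c k + b : ℕ) : ℝ) - j) / (A - j)) + (1 - g) * ((((∑ k ∈ W, c k : ℕ) : ℝ) - j) / (A - j))) =
      (1 / (A - j)) * ((∏ k, if k ∈ W then p k else 1 - p k) * (∑ k ∈ W, (c k : ℝ))) +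
        ((g * b - j) / (A - j)) * (∏ k, if k ∈ W then p k else 1 - p k) := by
    intro W
    push_cast
    field_simp
    ring
  rw [Finset.sum_congr rfl fun W _ => e1 W, Finset.sum_add_distrib, ← Finset.mul_sum, ← Finset.mul_sum,
    sum_bernoulliWeight_mul_count p (fun i => (c i : ℝ)), sum_bernoulliWeight]
  field_simp
  ring

/-- **The algebra of the empty third case.**  For `0 < x < 1` with `x³ + x ≥ 1`, `x² ≤ g ≤ x`, `0 ≤ b ≤ j`:
`b·x·g·(1 − 2x + g) ≤ j·(1 − x)·(g(1 + x) − x)`.  (The difference is a concave quadratic in `g` which is `(1−x)x²(j−b) ≥ 0` at `g = x` and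
`x(1−x)(j(x² + x − 1) − b x²(1−x)) ≥ x(1−x)·j·(x³ + x − 1) ≥ 0` at `g = x²`.) [this work] -/
theorem oneLight_noGap (x g b j : ℝ) (hx0 : 0 < x) (hx1 : x < 1) (hx3 : 1 ≤ x ^ 3 + x)
    (hgl : x ^ 2 ≤ g) (hgu : g ≤ x) (hb0 : 0 ≤ b) (hbj : b ≤ j) :
    b * x * g * (1 - 2 * x + g) ≤ j * (1 - x) * (g * (1 + x) - x) := by
  -- `F(g) := RHS − LHS`; `F(g)·(x − x²) = (x − g)·F(x²) + (g − x²)·F(x) + b x (g − x²)(x − g)(x − x²)`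
  have hj0 : 0 ≤ j := hb0.trans hbj
  have hFx : 0 ≤ (1 - x) * x ^ 2 * (j - b) := by
    have : 0 ≤ j - b := by linarith
    have : 0 ≤ 1 - x := by linarith
    positivity
  have hFx2 : 0 ≤ x * (1 - x) * (j * (x ^ 2 + x - 1) - b * x ^ 2 * (1 - x)) := by
    have h1 : 0 ≤ x * (1 - x) := by nlinarith
    have h2 : 0 ≤ j * (x ^ 2 + x - 1) - b * x ^ 2 * (1 - x) := by
      have h3 : b * x ^ 2 * (1 - x) ≤ j * (x ^ 2 * (1 - x)) := by nlinarith
      nlinarith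
    exact mul_nonneg h1 h2
  have hxg : 0 ≤ x - g := by linarith
  have hgx : 0 ≤ g - x ^ 2 := by linarith
  have hxx : 0 < x - x ^ 2 := by nlinarith
  have key : (j * (1 - x) * (g * (1 + x) - x) - b * x * g * (1 - 2 * x + g)) * (x - x ^ 2) =
      (x - g) * (x * (1 - x) * (j * (x ^ 2 + x - 1) - b * x ^ 2 * (1 - x))) +
        (g - x ^ 2) * ((1 - x) * x ^ 2 * (j - b)) + b * x * (g - x ^ 2) * (x - g) * (x - x ^ 2) := by
    ring
  have hprod : 0 ≤ (j * (1 - x) * (g * (1 + x) - x) - b * x * g * (1 - 2 * x + g)) * (x - x ^ 2) := by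
    rw [key]
    have t3 : 0 ≤ b * x * (g - x ^ 2) * (x - g) * (x - x ^ 2) := by
      have := hxx.le
      positivity
    nlinarith [mul_nonneg hxg hFx2, mul_nonneg hgx hFx]
  nlinarith

/-- **DIB\* WITH ONE LIGHT BLOB, reliable regime.**  Independent heavy blobs `i ∈ ι` of sizes `c i ∈ ℕ` and gates `x ≤ p i ≤ 1`, and one
independent LIGHT blob of size `b ≤ j` and gate `g` with `x² ≤ g ≤ x`; floor `0 < x < 1` with `x³ + x ≥ 1`.  If the discounted credit
exceeds `2j`, `2j < Σ_i c i·p i + b·(g − x²)/(1 − x)`, then the tail is at least the floor: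
`x ≤ P(N ≥ j+1) = Σ_W wt(W)·(g·𝟙[j+1 ≤ Σ_{k∈W} c k + b] + (1 − g)·𝟙[j+1 ≤ Σ_{k∈W} c k])`.
Proof: merge (`Quant.Merge.exists_tailMerge_le` + `far_indepBlob`), or Markov (`tail_ge_markov`), or `oneLight_noGap`. [this work] -/
theorem tail_ge_of_oneLight (p : ι → ℝ) (c : ι → ℕ) (x g : ℝ) (b j : ℕ)
    (hx0 : 0 < x) (hx1 : x < 1) (hx3 : 1 ≤ x ^ 3 + x)
    (hp : ∀ i, x ≤ p i) (hp1 : ∀ i, p i ≤ 1) (hgl : x ^ 2 ≤ g) (hgu : g ≤ x) (hbj : b ≤ j)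
    (hcredit : (2 * j : ℝ) < (∑ i, (c i : ℝ) * p i) + b * ((g - x ^ 2) / (1 - x))) :
    x ≤ ∑ W : Finset ι, (∏ k, if k ∈ W then p k else 1 - p k) *
        (g * (if j + 1 ≤ ∑ k ∈ W, c k + b then (1 : ℝ) else 0) +
          (1 - g) * (if j + 1 ≤ ∑ k ∈ W, c k then (1 : ℝ) else 0)) := by
  have hp0 : ∀ i, 0 ≤ p i := fun i => hx0.le.trans (hp i)
  have hg0 : 0 ≤ g := le_trans (sq_nonneg x) hgl
  have hg1 : g ≤ 1 := hgu.trans hx1.le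
  have hw0 : ∀ W : Finset ι, 0 ≤ (∏ k, if k ∈ W then p k else 1 - p k) := bernoulliWeight_nonneg hp0 hp1
  set C : ℝ := ∑ i, (c i : ℝ) with hC
  set B : ℝ := ∑ i, (c i : ℝ) * p i with hB
  have hC0 : 0 ≤ C := Finset.sum_nonneg fun i _ => Nat.cast_nonneg _
  have hBC : B ≤ C := Finset.sum_le_sum fun i _ => by
    have := hp1 i; have : (0 : ℝ) ≤ c i := Nat.cast_nonneg _
    nlinarith
  have hkappa : (g - x ^ 2) / (1 - x) ≤ x := by
    rw [div_le_iff₀ (by linarith)]; nlinarith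
  have hb0 : (0 : ℝ) ≤ b := Nat.cast_nonneg _
  have hbj' : (b : ℝ) ≤ j := by exact_mod_cast hbj
  -- total mass exceeds `j`
  have hAj : (j : ℝ) < C + b := by
    have h1 : (b : ℝ) * ((g - x ^ 2) / (1 - x)) ≤ b * x := mul_le_mul_of_nonneg_left hkappa hb0
    have h2 : (b : ℝ) * x ≤ b := by nlinarith
    have hj0 : (0 : ℝ) ≤ j := Nat.cast_nonneg _
    linarith
  by_cases hM : (1 - x) * j + x * (C + b) ≤ B + b * g
  · -- (M) Markov on the closed mass
    have hmk := tail_ge_markov p hp0 hp1 c b j g hg0 hg1 hAj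
    refine le_trans ?_ hmk
    rw [le_div_iff₀ (by linarith)]
    linarith
  by_cases hG : (j : ℝ) ≤ g * C
  · -- (G) merge the light blob into some heavy blob, then `far_indepBlob`
    have hpos : ∃ k, 0 < c k := by
      by_contra hnone
      push Not at hnone
      have hC0' : C = 0 := by
        rw [hC]; exact Finset.sum_eq_zero fun i _ => by simp [Nat.le_zero.mp (hnone i)]
      have hB0 : B = 0 := by
        rw [hB]; exact Finset.sum_eq_zero fun i _ => by simp [Nat.le_zero.mp (hnone i)]
      -- then the credit forces `2j < b·x ≤ j`, contradiction unless `j = 0`, and `j = 0` forces `b = 0`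
      have h1 : (b : ℝ) * ((g - x ^ 2) / (1 - x)) ≤ b * x := mul_le_mul_of_nonneg_left hkappa hb0
      have hj0 : (0 : ℝ) ≤ j := Nat.cast_nonneg _
      rw [hB0] at hcredit
      nlinarith
    obtain ⟨ℓ, -, hℓ⟩ := Quant.Merge.exists_tailMerge_le (fun W : Finset ι => ∏ k, if k ∈ W then p k else 1 - p k) hw0
      (fun W => W) (fun _ => 0) c b j g (by simpa [hC] using hG) hpos
    simp only [add_zero] at hℓ
    refine le_trans ?_ hℓ
    -- the merged collection: sizes `c' = c + b·δ_ℓ`, proper, budget `> 2j`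
    set c' : ι → ℕ := fun k => if k = ℓ then c k + b else c k with hc'
    have hc'k : ∀ k, c' k = c k + (if k = ℓ then b else 0) := by
      intro k; simp only [hc']; split_ifs <;> simp
    have hsum' : ∀ W : Finset ι, ∑ k ∈ W, c k + (if ℓ ∈ W then b else 0) = ∑ k ∈ W, c' k := by
      intro W
      rw [Finset.sum_congr rfl (fun k _ => hc'k k), Finset.sum_add_distrib, Finset.sum_ite_eq' W ℓ (fun _ => b)]
    have hbudget : (2 * j : ℝ) < 0 * x + ∑ i, (c' i : ℝ) * p i := by
      have e : ∑ i, (c' i : ℝ) * p i = B + b * p ℓ := by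
        have h' : ∀ i, (c' i : ℝ) * p i = (c i : ℝ) * p i + (if i = ℓ then (b : ℝ) * p i else 0) := by
          intro i; rw [hc'k i]; push_cast; split_ifs <;> ring
        rw [Finset.sum_congr rfl fun i _ => h' i, Finset.sum_add_distrib, Finset.sum_ite_eq' Finset.univ ℓ (fun i => (b : ℝ) * p i)]
        simp [hB]
      rw [e, zero_mul, zero_add]
      have h1 : (b : ℝ) * ((g - x ^ 2) / (1 - x)) ≤ b * x := mul_le_mul_of_nonneg_left hkappa hb0
      have h2 : (b : ℝ) * x ≤ b * p ℓ := mul_le_mul_of_nonneg_left (hp ℓ) hb0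
      linarith
    have hfar := far_indepBlob p (fun i => (c' i : ℝ)) x 0 hx0.le hx1.le hp hp1 (fun i => Nat.cast_nonneg _) le_rfl (j : ℝ) hbudget
    simp only [add_zero] at hfar
    -- `hfar : x * P(X' ≤ j) + (1 − x) * P(X' ≤ j) ≤ 1 − x`, i.e. `P(X' ≤ j) ≤ 1 − x`
    have hPle : ∑ W ∈ (Finset.univ : Finset (Finset ι)).filter (fun W => ∑ i ∈ W, (c' i : ℝ) ≤ j),
        (∏ k, if k ∈ W then p k else 1 - p k) ≤ 1 - x := by nlinarith
    -- complement: the merged tail is `1 − P(X' ≤ j)`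
    have htot := Finset.sum_filter_add_sum_filter_not (Finset.univ : Finset (Finset ι)) (fun W => ∑ i ∈ W, (c' i : ℝ) ≤ j)
      (fun W => ∏ k, if k ∈ W then p k else 1 - p k)
    rw [sum_bernoulliWeight] at htot
    have htail : ∑ W : Finset ι, (∏ k, if k ∈ W then p k else 1 - p k) *
        (if j + 1 ≤ ∑ k ∈ W, c k + (if ℓ ∈ W then b else 0) then (1 : ℝ) else 0) =
        ∑ W ∈ (Finset.univ : Finset (Finset ι)).filter (fun W => ¬ (∑ i ∈ W, (c' i : ℝ) ≤ j)),
          (∏ k, if k ∈ W then p k else 1 - p k) := by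
      rw [Finset.sum_filter]
      refine Finset.sum_congr rfl fun W _ => ?_
      rw [hsum' W]
      have hiff : j + 1 ≤ ∑ k ∈ W, c' k ↔ ¬ (∑ i ∈ W, (c' i : ℝ) ≤ j) := by
        rw [← Nat.cast_sum, Nat.cast_le, not_le, Nat.lt_iff_add_one_le]
      by_cases h : j + 1 ≤ ∑ k ∈ W, c' k
      · rw [if_pos h, if_pos (hiff.mp h), mul_one]
      · rw [if_neg h, if_neg (fun h' => h (hiff.mpr h')), mul_zero]
    rw [htail]
    linarith
  · -- (∅) the third case is empty
    exfalso
    push Not at hM hG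
    have hgpos : 0 < g := lt_of_lt_of_le (by positivity) hgl
    -- combine ¬M, ¬G and the credit: `j(1−x)(g(1+x) − x) < b x g (1 − 2x + g)`, contradicting `oneLight_noGap`
    have h1x : 0 < 1 - x := by linarith
    have hcr : (2 : ℝ) * j * (1 - x) < B * (1 - x) + b * (g - x ^ 2) := by
      have e : (B + b * ((g - x ^ 2) / (1 - x))) * (1 - x) = B * (1 - x) + b * (g - x ^ 2) := by
        field_simp
      have := mul_lt_mul_of_pos_right hcredit h1x
      linarith
    have P1 : (B + b * g) * (1 - x) * g < ((1 - x) * j + x * (C + b)) * (1 - x) * g :=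
      mul_lt_mul_of_pos_right (mul_lt_mul_of_pos_right hM h1x) hgpos
    have P2 : x * (1 - x) * (g * C) < x * (1 - x) * j := mul_lt_mul_of_pos_left hG (mul_pos hx0 h1x)
    have P3 : (2 : ℝ) * j * (1 - x) * g < (B * (1 - x) + b * (g - x ^ 2)) * g := mul_lt_mul_of_pos_right hcr hgpos
    have hlt : (j : ℝ) * (1 - x) * (g * (1 + x) - x) < b * x * g * (1 - 2 * x + g) := by
      nlinarith [P1, P2, P3]
    have hng := oneLight_noGap x g b j hx0 hx1 hx3 hgl hgu hb0 hbj'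
    linarith

end IndepBlob

end Quant

end Summit.CriticalPhenomena.PercolationContinuityZ3.Theorems
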